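import Literature.Probability.Process.BrownianLoopDensity4
import Literature.Probability.Process.BrownianVecHitFrom
import Literature.Probability.Process.BrownianVecStoppedIncrements
import Literature.Probability.RandomPlanarGeometry.BubbleHittingHarmonic
import HarnessLib

/-!
# The supermartingale inequality for `|W|⁻²` at the dyadic approximants of a hitting time (four-dimensional Brownian motion)

Topic `Probability/Process`; one small definition (`newtonR v = 1/(v₀²+v₁²+v₂²+v₃²)`, the real
Newtonian weight of `ℝ⁴`, = `newtonFour` of `BrownianLoopDensity4` before `ENNReal.ofReal`) and
theorems, no named fact. For a four-dimensional Brownian motion `W` (`IsBrownianVec`, `d = 4`), a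
closed bounded set `F` with `sqSum ≥ δ² > 0` on `F` (so `0 ∉ F`), its hitting time `τ`
(`hitFrom W F 0`) and the dyadic upper approximants `τ_n = dyadicCeilTop n τ` of the tree
(`StoppedMartingale`):

* `IsBrownianVec.lintegral_newtonR_dyadicCeil_le` —
  **`E[𝟙{τ < ∞} |W_{τ_n}|⁻²] ≤ E[𝟙{τ < ∞} |W_τ|⁻²]`** (lower Lebesgue integrals).

This is the supermartingale property of the positive local martingale `|W_t|⁻²` (`|·|⁻²` is the
Newtonian potential of `ℝ⁴`) between `τ` and `τ_n ≥ τ`, proved WITHOUT the strong Markov property: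
Dynkin's identity between two stopping times along confined paths (the tree's
`IsBrownianVec.setIntegral_stopped_sub_of_confined`, `BrownianVecStoppedIncrements`) for the
harmonic function `N = |·|⁻²` written off the axis `{w = 0}` as the excursion ratio of `z ↦ −1/z`
(`RandomPlanarGeometry.negInvEmpty`, `excursionRatio_negInvEmpty`, harmonic by
`lap_excursionRatio_eq_zero`), on the events
`A_k = {τ ≤ k} ∩ {τ < S_k} ∩ {|w(W_τ)| > 1/(k+1)} ∈ 𝓕_τ` and between `τ` and
`σ_k = (τ_n ∧ ρ_k) ∧ (S_k ∨ τ)` (`S_k` the exit time of the sup-norm ball of radius `|R₀|+k+2`,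
`ρ_k` the first time after `τ` with `|w| ≤ 1/(k+1)`); this gives
`E[𝟙_{E_k} |W_{τ_n}|⁻²] ≤ E[𝟙{τ<∞}|W_τ|⁻²]` with
`E_k = A_k ∩ {τ_n ≤ k, τ_n < ρ_k, τ_n < S_k}` and no error term, and `E_k ↑` exhausts `{τ < ∞}`
almost surely (the axis is not visited at positive times, `ae_forall_pos_spRad_pos`; paths are
bounded on compact time intervals), so monotone convergence concludes.

It is the upper-bound half of the identification of the hitting masses of the Brownian loop
measure at `0` in `ℝ⁴` (`BrownianLoopDensity4`: the `h`-transform density with `h = |·|⁻²`), the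
lower bound being Fatou's lemma; see `BrownianLoopHitting4`.

Also: `hittingFrom_anti_set`, `mem_closure_compl_of_le_hittingFrom` (hitting after a random time:
monotonicity in the set, confinement in `closure Gᶜ` up to the hitting time).

## References

* J.-F. Le Gall, *Brownian Motion, Martingales, and Stochastic Calculus*, GTM 274 (2016), Ch. 7
  §7.2 (harmonic functions of Brownian motion, optional stopping), Prop. 7.16 (polar sets).
  [Legall2016]
-/

noncomputable section
open MeasureTheory ProbabilityTheory Filter Topology Set Metric
open scoped NNReal ENNReal

namespace Literature.Probability.Process

namespace IsBrownianVec

open Literature.Probability.RandomPlanarGeometry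

variable {Ω : Type*} {mΩ : MeasurableSpace Ω} {P : Measure Ω} {W : ℝ≥0 → Ω → (Fin 4 → ℝ)}

/-- The Newtonian weight `N(v) = 1/(v₀² + v₁² + v₂² + v₃²)` (junk `0` at `v = 0`). [folklore] -/
def newtonR (v : Fin 4 → ℝ) : ℝ := (sqSum v)⁻¹

/-- `N ≥ 0`. [folklore] -/
theorem newtonR_nonneg (v : Fin 4 → ℝ) : 0 ≤ newtonR v := inv_nonneg.2 (sqSum_nonneg v)

/-- `N = 1/|x + i|w||²` is the excursion ratio of `z ↦ −1/z` off the axis. [folklore] -/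
theorem newtonR_eq_excursionRatio {v : Fin 4 → ℝ} (hv : exRad v ≠ 0) :
    newtonR v = excursionRatio negInvEmpty v := by
  rw [excursionRatio_negInvEmpty hv, newtonR]
  congr 1
  rw [Complex.normSq_apply, exPt_re, exPt_im, ← sq, ← sq, exRad_sq, exSq, sqSum, Fin.sum_univ_four]
  ring

/-- `exRad² ≤ sqSum`, so `N ≤ 1/|w|²`. [folklore] -/
theorem newtonR_le_of_exRad {v : Fin 4 → ℝ} {η : ℝ} (hη : 0 < η) (hv : η ≤ exRad v) : newtonR v ≤ 1 / η ^ 2 := by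
  have h1 : η ^ 2 ≤ exRad v ^ 2 := pow_le_pow_left₀ hη.le hv 2
  have h2 : exRad v ^ 2 ≤ sqSum v := by
    rw [exRad_sq, exSq, sqSum, Fin.sum_univ_four]; nlinarith [sq_nonneg (v 0)]
  rw [newtonR, one_div]
  exact inv_anti₀ (by positivity) (h1.trans h2)

/-- `N ≥ 0` for the excursion ratio of `−1/z`, everywhere (junk `0` on the axis). [folklore] -/
theorem excursionRatio_negInvEmpty_nonneg' (v : Fin 4 → ℝ) : 0 ≤ excursionRatio negInvEmpty v := by
  by_cases hv : exRad v ≠ 0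
  · exact excursionRatio_negInvEmpty_nonneg hv
  · push Not at hv
    simp [excursionRatio, hv]

/-! ### Hitting after a random time: two more facts -/

section HittingFromFacts

variable {d : ℕ} {W' : ℝ≥0 → Ω → (Fin d → ℝ)}

/-- A larger set is hit earlier (hitting after a random time; closed sets, continuous paths). [folklore] -/
theorem hittingFrom_anti_set (hW : IsBrownianVec W' P) {s s' : Set (Fin d → ℝ)} (hs : IsClosed s)
    (hss' : s ⊆ s') (T : Ω → WithTop ℝ≥0) (ω : Ω) :
    hittingFrom (fun t ω ↦ W' t ω) s' T ω ≤ hittingFrom (fun t ω ↦ W' t ω) s T ω := by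
  induction h : hittingFrom (fun t ω ↦ W' t ω) s T ω with
  | top => exact le_top
  | coe T₁ =>
    have hmem : W' T₁ ω ∈ s := mem_of_hittingFrom_eq_coe hs (hW.continuous_path ω) h
    have hT : T ω ≤ T₁ := by rw [← h]; exact le_hittingFrom
    exact hittingFrom_le_of_mem hT (hss' hmem)

/-- **Up to `t ∧ (hitting time of `G` after `T`)`, from `T` on, the path stays in `closure Gᶜ`**, if
`W_T ∉ G` (`T` finite). [folklore] -/
theorem mem_closure_compl_of_le_hittingFrom (hW : IsBrownianVec W' P) {G : Set (Fin d → ℝ)}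
    (hG : IsClosed G) {T : Ω → WithTop ℝ≥0} {ω : Ω} {T₀ : ℝ≥0} (hT₀ : T ω = T₀) (h0 : W' T₀ ω ∉ G)
    (t : ℝ≥0) {r : ℝ≥0} (hr1 : T₀ ≤ r)
    (hr2 : r ≤ (min (t : WithTop ℝ≥0) (hittingFrom (fun t ω ↦ W' t ω) G T ω)).untopA) :
    W' r ω ∈ closure Gᶜ := by
  set τ' := hittingFrom (fun t ω ↦ W' t ω) G T ω with hτ'
  have hcont : Continuous fun s : ℝ≥0 ↦ W' s ω := hW.continuous_path ω
  by_cases hlt : (r : WithTop ℝ≥0) < τ'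
  · exact subset_closure (notMem_of_lt_hittingFrom (by rw [hT₀]; exact_mod_cast hr1) hlt)
  · induction hT : τ' with
    | top => exact absurd (hT ▸ WithTop.coe_lt_top r) hlt
    | coe T₁ =>
      rw [hT] at hlt hr2
      rw [untopA_min_coe_coe] at hr2
      have hrT : r = T₁ := le_antisymm (hr2.trans (min_le_right _ _)) (not_lt.1 (by exact_mod_cast hlt))
      subst hrT
      have hmem : W' r ω ∈ G := mem_of_hittingFrom_eq_coe hG hcont hT
      have hs₀r : T₀ < r := lt_of_le_of_ne hr1 fun h ↦ h0 (h ▸ hmem)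
      have hS : IsClosed {s : ℝ≥0 | W' s ω ∈ closure Gᶜ} := isClosed_closure.preimage hcont
      have hsub : Ico T₀ r ⊆ {s : ℝ≥0 | W' s ω ∈ closure Gᶜ} := fun s hs ↦ by
        have hs' : (s : WithTop ℝ≥0) < τ' := by rw [hT]; exact_mod_cast hs.2
        exact subset_closure (notMem_of_lt_hittingFrom (by rw [hT₀]; exact_mod_cast hs.1) hs')
      have hcl : closure (Ico T₀ r) ⊆ {s : ℝ≥0 | W' s ω ∈ closure Gᶜ} := closure_minimal hsub hS
      apply hcl
      rw [closure_Ico hs₀r.ne]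
      exact ⟨hs₀r.le, le_rfl⟩

end HittingFromFacts

/-- **The supermartingale inequality for `|W|⁻²` between a hitting time and its dyadic
approximants.** Let `W` be a four-dimensional Brownian motion, `F` closed and bounded with
`sqSum ≥ δ² > 0` on `F` (so `0 ∉ F`), `τ` the hitting time of `F` and `τ_n = ⌈τ⌉ₙ` its `n`-th
dyadic approximant from above (`dyadicCeil`). Then

  `E[𝟙{τ < ∞} |W_{τ_n}|⁻²] ≤ E[𝟙{τ < ∞} |W_τ|⁻²]`.

Dynkin's identity between the stopping times `τ` and `τ_n ∧ ρ_η ∧ (S_R ∨ τ)` on the event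
`{τ ≤ t, τ < S_R, |w(W_τ)| > η} ∈ 𝓕_τ` (`setIntegral_stopped_sub_of_confined` for `N = |·|⁻²`,
harmonic off the axis as the excursion ratio of `−1/z`; `S_R` the exit time of a large ball, `ρ_η`
the first time after `τ` that `|w| ≤ η`), which gives
`E[𝟙{…, τ_n ≤ t, τ_n < ρ_η ∧ S_R} |W_{τ_n}|⁻²] ≤ E[𝟙{τ<∞}|W_τ|⁻²]` with no error term; then
monotone convergence along `t, R → ∞`, `η → 0` (the axis is not visited after the positive
time `τ`). [cite: Legall2016, Ch. 7 §7.2 (harmonic functions and optional stopping)] -/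
theorem lintegral_newtonR_dyadicCeil_le [IsProbabilityMeasure P] (hW : IsBrownianVec W P)
    {F : Set (Fin 4 → ℝ)} (hF : IsClosed F) (hFb : Bornology.IsBounded F) {δ : ℝ} (hδ : 0 < δ)
    (hFδ : ∀ v ∈ F, δ ^ 2 ≤ sqSum v) (n : ℕ) :
    ∫⁻ ω, {ω | hitFrom W F 0 ω ≠ ⊤}.indicator
        (fun ω ↦ ENNReal.ofReal (newtonR (W (dyadicCeil n (hitFrom W F 0 ω).untopA) ω))) ω ∂P ≤
      ∫⁻ ω, {ω | hitFrom W F 0 ω ≠ ⊤}.indicator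
        (fun ω ↦ ENNReal.ofReal (newtonR (W (hitFrom W F 0 ω).untopA ω))) ω ∂P := by
  classical
  -- the hitting time and its dyadic approximant
  set τ := hitFrom W F 0 with hτdef
  have hτ : IsStoppingTime hW.natFiltration τ := hW.isStoppingTime_hitFrom hF 0
  set τn : Ω → WithTop ℝ≥0 := fun ω ↦ dyadicCeilTop n (τ ω) with hτndef
  have hτn : IsStoppingTime hW.natFiltration τn := hτ.isOptionalTime.isStoppingTime_dyadicCeilTop n
  have hττn : ∀ ω, τ ω ≤ τn ω := fun ω ↦ le_dyadicCeilTop n (τ ω)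
  have hprog : IsStronglyProgressive hW.natFiltration fun t ω ↦ W t ω :=
    hW.stronglyAdapted.isStronglyProgressive_of_continuous hW.continuous_path
  -- `τ > 0`: the origin is not in `F`
  have hW0 : ∀ ω, W 0 ω ∉ F := fun ω h ↦ by
    have := hFδ _ h
    rw [hW.apply_zero] at this
    simp [sqSum] at this
    nlinarith
  -- radii
  obtain ⟨R₀, hR₀⟩ := hFb.subset_closedBall (0 : Fin 4 → ℝ)
  set η : ℕ → ℝ := fun k ↦ 1 / ((k : ℝ) + 1) with hηdef
  have hη : ∀ k, 0 < η k := fun k ↦ by simp only [hηdef]; positivity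
  have hηanti : ∀ k l, k ≤ l → η l ≤ η k := fun k l hkl ↦ by
    simp only [hηdef]
    have : (k : ℝ) ≤ l := by exact_mod_cast hkl
    exact one_div_le_one_div_of_le (by positivity) (by linarith)
  set Rk : ℕ → ℝ := fun k ↦ |R₀| + k + 2 with hRkdef
  -- obstacle sets, stopping times
  set O : ℕ → Set (Fin 4 → ℝ) := fun k ↦ {v | exRad v ≤ η k} with hOdef
  set Gk : ℕ → Set (Fin 4 → ℝ) := fun k ↦ {v | Rk k ≤ ‖v‖} with hGdef
  have hOc : ∀ k, IsClosed (O k) := fun k ↦ isClosed_le continuous_exRad continuous_const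
  have hGc : ∀ k, IsClosed (Gk k) := fun k ↦ isClosed_le continuous_const continuous_norm
  set S : ℕ → Ω → WithTop ℝ≥0 := fun k ↦ hitFrom W (Gk k) 0 with hSdef
  have hS : ∀ k, IsStoppingTime hW.natFiltration (S k) := fun k ↦ hW.isStoppingTime_hitFrom (hGc k) 0
  set ρ : ℕ → Ω → WithTop ℝ≥0 := fun k ↦ hittingFrom (fun t ω ↦ W t ω) (O k) τ with hρdef
  have hρ : ∀ k, IsStoppingTime hW.natFiltration (ρ k) := fun k ↦
    isStoppingTime_hittingFrom (fun t ↦ hW.measurable_apply_le (le_refl t)) hW.continuous_path (hOc k) hτ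
  set σ : ℕ → Ω → WithTop ℝ≥0 := fun k ω ↦ min (min (τn ω) (ρ k ω)) (max (S k ω) (τ ω)) with hσdef
  have hσ : ∀ k, IsStoppingTime hW.natFiltration (σ k) := fun k ↦ (hτn.min (hρ k)).min ((hS k).max hτ)
  have hτσ : ∀ k, τ ≤ σ k := fun k ω ↦
    le_min (le_min (hττn ω) le_hittingFrom) (le_max_of_le_right le_rfl)
  -- the events
  set A : ℕ → Set Ω := fun k ↦ {ω | τ ω ≤ (k : ℝ≥0)} ∩ {ω | ¬ S k ω ≤ τ ω} ∩
    {ω | η k < exRad (stoppedValue (fun t ω ↦ W t ω) τ ω)} with hAdef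
  set E : ℕ → Set Ω := fun k ↦ A k ∩ ({ω | τn ω ≤ (k : ℝ≥0)} ∩ {ω | ¬ ρ k ω ≤ τn ω} ∩ {ω | ¬ S k ω ≤ τn ω})
    with hEdef
  have hAmτ : ∀ k, MeasurableSet[hτ.measurableSpace] (A k) := fun k ↦ by
    refine ((hτ.measurableSet_le' _).inter (IsStoppingTime.measurableSet_stopping_time_le (hS k) hτ).compl).inter ?_
    exact measurableSet_lt (measurable_const (a := η k))
      (continuous_exRad.measurable.comp (measurable_stoppedValue hprog hτ))
  have hAm : ∀ k, MeasurableSet (A k) := fun k ↦ hτ.measurableSpace_le _ (hAmτ k)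
  have hEm : ∀ k, MeasurableSet (E k) := fun k ↦ by
    refine (hAm k).inter (((hτn.measurableSpace_le _ (hτn.measurableSet_le' _)).inter ?_).inter ?_)
    · exact (hτn.measurableSpace_le _ (IsStoppingTime.measurableSet_stopping_time_le (hρ k) hτn)).compl
    · exact (hτn.measurableSpace_le _ (IsStoppingTime.measurableSet_stopping_time_le (hS k) hτn)).compl
  -- the harmonic function `N` as an excursion ratio, its measurable version, the regions
  set V : (Fin 4 → ℝ) → ℝ := excursionRatio negInvEmpty with hVdef
  set Vb : (Fin 4 → ℝ) → ℝ := (exDom (∅ : Set ℂ)).indicator V with hVbdef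
  have hVbm : Measurable Vb := measurable_indicator_excursionRatio isClosed_empty
  have hVnn : ∀ v, 0 ≤ V v := excursionRatio_negInvEmpty_nonneg'
  have hVbnn : ∀ v, 0 ≤ Vb v := fun v ↦ by
    simp only [hVbdef]; by_cases hv : v ∈ exDom (∅ : Set ℂ)
    · rw [indicator_of_mem hv]; exact hVnn v
    · rw [indicator_of_notMem hv]
  have hVeq : ∀ {v : Fin 4 → ℝ} {e : ℝ}, 0 < e → e ≤ exRad v → V v = newtonR v ∧ Vb v = newtonR v := by
    intro v e he hev
    have hv : exRad v ≠ 0 := (he.trans_le hev).ne'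
    have h1 : V v = newtonR v := (newtonR_eq_excursionRatio hv).symm
    refine ⟨h1, ?_⟩
    rw [hVbdef, indicator_of_mem (show v ∈ exDom (∅ : Set ℂ) from ⟨hv, fun h ↦ h⟩), h1]
  set U : ℕ → Set (Fin 4 → ℝ) := fun k ↦ {v | η k / 2 < exRad v} with hUdef
  have hUo : ∀ k, IsOpen (U k) := fun k ↦ isOpen_lt continuous_const continuous_exRad
  have hUD : ∀ k, U k ⊆ exDom (∅ : Set ℂ) := fun k v hv ↦
    ⟨((half_pos (hη k)).trans hv).ne', fun h ↦ h⟩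
  have hVC : ∀ k, ContDiffOn ℝ 2 V (U k) := fun k ↦
    (contDiffOn_excursionRatio_two isClosed_empty).mono (hUD k)
  have hVΔ : ∀ k, ∀ y ∈ U k, lap V y = (0 : ℝ) := fun k y hy ↦ lap_excursionRatio_eq_zero isClosed_empty (hUD k hy)
  set K : ℕ → Set (Fin 4 → ℝ) := fun k ↦ {v | η k ≤ exRad v} ∩ closedBall 0 (Rk k) with hKdef
  have hKc : ∀ k, IsCompact (K k) := fun k ↦
    (isCompact_closedBall _ _).inter_left (isClosed_le continuous_const continuous_exRad)
  have hKU : ∀ k, K k ⊆ U k := fun k v hv ↦ by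
    have := hv.1; simp only [mem_setOf_eq] at this ⊢
    simp only [hUdef, mem_setOf_eq]; linarith [hη k]
  -- the stopped values and the confinement
  have hW0G : ∀ k ω, W 0 ω ∉ Gk k := fun k ω h ↦ by
    have h' : Rk k ≤ ‖W 0 ω‖ := h
    rw [hW.apply_zero, norm_zero] at h'
    have : (0 : ℝ) < Rk k := by simp only [hRkdef]; positivity
    linarith
  have hconf : ∀ k, ∀ ω ∈ A k, ∀ r : ℝ≥0, (min ((k : ℝ≥0) : WithTop ℝ≥0) (τ ω)).untopA ≤ r →
      r ≤ (min ((k : ℝ≥0) : WithTop ℝ≥0) (σ k ω)).untopA → (0 : Fin 4 → ℝ) + W r ω ∈ K k := by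
    intro k ω hω r hr1 hr2
    obtain ⟨⟨hτk, hSτ⟩, hex⟩ := hω
    have hτk' : τ ω ≤ (k : ℝ≥0) := hτk
    have hex' : η k < exRad (stoppedValue (fun t ω ↦ W t ω) τ ω) := hex
    rw [zero_add]
    have hτne : τ ω ≠ ⊤ := ne_top_of_le_ne_top WithTop.coe_ne_top hτk'
    obtain ⟨T₀, hT₀⟩ := WithTop.ne_top_iff_exists.1 hτne
    have hT₀' : τ ω = T₀ := hT₀.symm
    have hT₀k : T₀ ≤ (k : ℝ≥0) := by rw [hT₀'] at hτk'; exact_mod_cast hτk'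
    have hmin : (min ((k : ℝ≥0) : WithTop ℝ≥0) (τ ω)).untopA = T₀ := by
      rw [hT₀', min_eq_right (by exact_mod_cast hT₀k)]; rfl
    rw [hmin] at hr1
    have hsv : stoppedValue (fun t ω ↦ W t ω) τ ω = W T₀ ω := by
      simp only [stoppedValue, hT₀']; rfl
    rw [hsv] at hex'
    have hτS : τ ω < S k ω := not_le.1 hSτ
    have hmax : max (S k ω) (τ ω) = S k ω := max_eq_left hτS.le
    -- `r ≤ k ∧ ρ` and `r ≤ k ∧ S`
    have hσρ : σ k ω ≤ ρ k ω := (min_le_left _ _).trans (min_le_right _ _)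
    have hσS : σ k ω ≤ S k ω := by rw [← hmax]; exact min_le_right _ _
    have hrρ : r ≤ (min ((k : ℝ≥0) : WithTop ℝ≥0) (ρ k ω)).untopA := hr2.trans (untopA_min_coe_le_of_le _ hσρ)
    have hrS : r ≤ (min ((k : ℝ≥0) : WithTop ℝ≥0) (S k ω)).untopA := hr2.trans (untopA_min_coe_le_of_le _ hσS)
    refine ⟨?_, ?_⟩
    · -- `η ≤ exRad (W r ω)`
      have h0 : W T₀ ω ∉ O k := fun h ↦ by
        have : exRad (W T₀ ω) ≤ η k := h
        linarith [hex']
      have hcl := mem_closure_compl_of_le_hittingFrom hW (hOc k) hT₀' h0 (k : ℝ≥0) hr1 hrρ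
      have hsub : closure (O k)ᶜ ⊆ {v | η k ≤ exRad v} :=
        closure_minimal (fun v hv ↦ by
          have hv' : ¬ exRad v ≤ η k := hv
          exact (not_le.1 hv').le) (isClosed_le continuous_const continuous_exRad)
      exact hsub hcl
    · -- `‖W r ω‖ ≤ Rk`
      have hcl := hW.mem_closure_compl_of_le_hitFrom (hGc k) (hW0G k ω) (k : ℝ≥0) bot_le hrS
      have hsub : closure (Gk k)ᶜ ⊆ closedBall (0 : Fin 4 → ℝ) (Rk k) :=
        closure_minimal (fun v hv ↦ by
          have hv' : ¬ Rk k ≤ ‖v‖ := hv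
          exact mem_closedBall_zero_iff.2 (not_le.1 hv').le) isClosed_closedBall
      exact hsub hcl
  -- Step 1: the inequality on `E k`
  set fτ : Ω → ℝ≥0∞ := {ω | τ ω ≠ ⊤}.indicator fun ω ↦ ENNReal.ofReal (newtonR (W (τ ω).untopA ω)) with hfτ
  set f : ℕ → Ω → ℝ≥0∞ := fun k ↦ (E k).indicator fun ω ↦
    ENNReal.ofReal (newtonR (stoppedValue (fun t ω ↦ W t ω) τn ω)) with hfdef
  have hkey : ∀ k, ∫⁻ ω, f k ω ∂P ≤ ∫⁻ ω, fτ ω ∂P := by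
    intro k
    obtain ⟨hint, hzero⟩ := hW.setIntegral_stopped_sub_of_confined (hUo k) (hVC k) (hVΔ k) (hKc k) (hKU k)
      hτ (hσ k) (hτσ k) (hAmτ k) (k : ℝ≥0) (hconf k)
    simp only [zero_div, zero_mul, sub_zero, zero_add] at hint hzero
    -- the two stopped values, on `A k`
    set a : Ω → ℝ := fun ω ↦ Vb (W (min ((k : ℝ≥0) : WithTop ℝ≥0) (σ k ω)).untopA ω) with hadef
    set b : Ω → ℝ := fun ω ↦ Vb (W (min ((k : ℝ≥0) : WithTop ℝ≥0) (τ ω)).untopA ω) with hbdef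
    have ham : Measurable a := by
      have := hW.measurable_stoppedProcess_path 0 (hσ k) (k : ℝ≥0)
      simp only [zero_add] at this
      exact hVbm.comp this
    have hbm : Measurable b := by
      have := hW.measurable_stoppedProcess_path 0 hτ (k : ℝ≥0)
      simp only [zero_add] at this
      exact hVbm.comp this
    -- on `A k` the points are in `K k`, where `Vb = V = newtonR ≤ 1/η²`
    have hinK1 : ∀ ω ∈ A k, W (min ((k : ℝ≥0) : WithTop ℝ≥0) (σ k ω)).untopA ω ∈ K k := fun ω hω ↦ by
      have := hconf k ω hω _ ?_ le_rfl
      · rwa [zero_add] at this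
      · exact untopA_min_coe_le_of_le _ (hτσ k ω)
    have hinK2 : ∀ ω ∈ A k, W (min ((k : ℝ≥0) : WithTop ℝ≥0) (τ ω)).untopA ω ∈ K k := fun ω hω ↦ by
      have := hconf k ω hω _ le_rfl (untopA_min_coe_le_of_le _ (hτσ k ω))
      rwa [zero_add] at this
    have haV : ∀ ω ∈ A k, V (W (min ((k : ℝ≥0) : WithTop ℝ≥0) (σ k ω)).untopA ω) = a ω ∧
        |a ω| ≤ 1 / η k ^ 2 := fun ω hω ↦ by
      obtain ⟨h1, h2⟩ := hVeq (hη k) (hinK1 ω hω).1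
      refine ⟨by simp only [hadef]; rw [h2, h1], ?_⟩
      simp only [hadef]
      rw [h2, abs_of_nonneg (newtonR_nonneg _)]
      exact newtonR_le_of_exRad (hη k) (hinK1 ω hω).1
    have hbV : ∀ ω ∈ A k, V (W (min ((k : ℝ≥0) : WithTop ℝ≥0) (τ ω)).untopA ω) = b ω ∧
        |b ω| ≤ 1 / η k ^ 2 := fun ω hω ↦ by
      obtain ⟨h1, h2⟩ := hVeq (hη k) (hinK2 ω hω).1
      refine ⟨by simp only [hbdef]; rw [h2, h1], ?_⟩
      simp only [hbdef]
      rw [h2, abs_of_nonneg (newtonR_nonneg _)]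
      exact newtonR_le_of_exRad (hη k) (hinK2 ω hω).1
    have hai : IntegrableOn a (A k) P := by
      refine Integrable.mono' (integrable_const (1 / η k ^ 2)) ham.aestronglyMeasurable ?_
      exact (ae_restrict_iff' (hAm k)).2 (ae_of_all _ fun ω hω ↦ by
        rw [Real.norm_eq_abs]; exact (haV ω hω).2)
    have hbi : IntegrableOn b (A k) P := by
      refine Integrable.mono' (integrable_const (1 / η k ^ 2)) hbm.aestronglyMeasurable ?_
      exact (ae_restrict_iff' (hAm k)).2 (ae_of_all _ fun ω hω ↦ by
        rw [Real.norm_eq_abs]; exact (hbV ω hω).2)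
    -- `∫_A a = ∫_A b`
    have hab : ∫ ω in A k, a ω ∂P = ∫ ω in A k, b ω ∂P := by
      have h1 : ∫ ω in A k, (V (W (min ((k : ℝ≥0) : WithTop ℝ≥0) (σ k ω)).untopA ω) -
          V (W (min ((k : ℝ≥0) : WithTop ℝ≥0) (τ ω)).untopA ω)) ∂P = ∫ ω in A k, (a ω - b ω) ∂P :=
        setIntegral_congr_fun (hAm k) fun ω hω ↦ by rw [(haV ω hω).1, (hbV ω hω).1]
      rw [h1, integral_sub hai hbi] at hzero
      linarith
    -- compare the lower integrals
    calc ∫⁻ ω, f k ω ∂P ≤ ∫⁻ ω, (A k).indicator (fun ω ↦ ENNReal.ofReal (a ω)) ω ∂P := by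
          refine lintegral_mono fun ω ↦ ?_
          simp only [hfdef]
          by_cases hωE : ω ∈ E k
          · have hωA : ω ∈ A k := hωE.1
            rw [indicator_of_mem hωE, indicator_of_mem hωA]
            -- on `E k`, `k ∧ σ = τn`
            obtain ⟨⟨hτnk, hρn⟩, hSn⟩ := hωE.2
            have hτnne : τn ω ≠ ⊤ := ne_top_of_le_ne_top WithTop.coe_ne_top hτnk
            obtain ⟨Tn, hTn⟩ := WithTop.ne_top_iff_exists.1 hτnne
            have hσeq : σ k ω = Tn := by
              have hτS : τ ω < S k ω := not_le.1 hωA.1.2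
              have h1 : σ k ω = τn ω := by
                simp only [hσdef]
                rw [max_eq_left hτS.le, min_eq_left (not_le.1 hρn).le, min_eq_left (not_le.1 hSn).le]
              rw [h1, hTn]
            have hmin : (min ((k : ℝ≥0) : WithTop ℝ≥0) (σ k ω)).untopA = Tn := by
              rw [hσeq, min_eq_right (hTn ▸ hτnk)]; rfl
            have hsv : stoppedValue (fun t ω ↦ W t ω) τn ω = W Tn ω := by
              simp only [stoppedValue, ← hTn]; rfl
            have hKmem : W Tn ω ∈ K k := by
              have := hinK1 ω hωA; rwa [hmin] at this
            rw [hsv]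
            simp only [hadef, hmin]
            rw [(hVeq (hη k) hKmem.1).2]
          · rw [indicator_of_notMem hωE]; exact bot_le
      _ = ∫⁻ ω in A k, ENNReal.ofReal (a ω) ∂P := lintegral_indicator (hAm k) _
      _ = ENNReal.ofReal (∫ ω in A k, a ω ∂P) := by
          rw [ofReal_integral_eq_lintegral_ofReal hai (ae_of_all _ fun ω ↦ hVbnn _)]
      _ = ENNReal.ofReal (∫ ω in A k, b ω ∂P) := by rw [hab]
      _ = ∫⁻ ω in A k, ENNReal.ofReal (b ω) ∂P := by
          rw [ofReal_integral_eq_lintegral_ofReal hbi (ae_of_all _ fun ω ↦ hVbnn _)]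
      _ = ∫⁻ ω, (A k).indicator (fun ω ↦ ENNReal.ofReal (b ω)) ω ∂P := (lintegral_indicator (hAm k) _).symm
      _ ≤ ∫⁻ ω, fτ ω ∂P := by
          refine lintegral_mono fun ω ↦ ?_
          by_cases hωA : ω ∈ A k
          · have hτk' : τ ω ≤ (k : ℝ≥0) := hωA.1.1
            have hτne : τ ω ≠ ⊤ := ne_top_of_le_ne_top WithTop.coe_ne_top hτk'
            rw [indicator_of_mem hωA, hfτ, indicator_of_mem (show ω ∈ {ω | τ ω ≠ ⊤} from hτne)]
            obtain ⟨T₀, hT₀⟩ := WithTop.ne_top_iff_exists.1 hτne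
            have hT₀k : T₀ ≤ (k : ℝ≥0) := by
              rw [← hT₀] at hτk'; exact_mod_cast hτk'
            have hmin : (min ((k : ℝ≥0) : WithTop ℝ≥0) (τ ω)).untopA = T₀ := by
              rw [← hT₀, min_eq_right (by exact_mod_cast hT₀k)]; rfl
            have huT : (τ ω).untopA = T₀ := by rw [← hT₀]; rfl
            have hK2 : W T₀ ω ∈ K k := by
              have := hinK2 ω hωA; rwa [hmin] at this
            simp only [hbdef]
            rw [hmin, huT, (hVeq (hη k) hK2.1).2]
          · rw [indicator_of_notMem hωA]; exact bot_le
  -- Step 2: measurability and monotonicity of `f k`, exhaustion, monotone convergence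
  have hsvm : Measurable (stoppedValue (fun t ω ↦ W t ω) τn) :=
    (measurable_stoppedValue hprog hτn).mono (hτn.measurableSpace_le) le_rfl
  have hNm : Measurable newtonR := (measurable_sqSum).inv
  have hfm : ∀ k, Measurable (f k) := fun k ↦
    ((hNm.comp hsvm).ennreal_ofReal).indicator (hEm k)
  -- monotonicity of the events
  have hGmono : ∀ k, Gk (k + 1) ⊆ Gk k := fun k v hv ↦ by
    have hv' : Rk (k + 1) ≤ ‖v‖ := hv
    show Rk k ≤ ‖v‖
    simp only [hRkdef] at hv' ⊢; push_cast at hv' ⊢; linarith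
  have hOmono : ∀ k, O (k + 1) ⊆ O k := fun k v hv ↦ by
    have hv' : exRad v ≤ η (k + 1) := hv
    show exRad v ≤ η k
    exact hv'.trans (hηanti k (k + 1) (Nat.le_succ k))
  have hSmono : ∀ k ω, S k ω ≤ S (k + 1) ω := fun k ω ↦ hitFrom_anti (hGmono k) 0 ω hW (hGc (k + 1))
  have hρmono : ∀ k ω, ρ k ω ≤ ρ (k + 1) ω := fun k ω ↦
    hittingFrom_anti_set hW (hOc (k + 1)) (hOmono k) τ ω
  have hEmono : ∀ k, E k ⊆ E (k + 1) := by
    intro k ω hω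
    obtain ⟨⟨⟨h1, h2⟩, h3⟩, ⟨h4, h5⟩, h6⟩ := hω
    have h1' : τ ω ≤ (k : ℝ≥0) := h1
    have h3' : η k < exRad (stoppedValue (fun t ω ↦ W t ω) τ ω) := h3
    have h4' : τn ω ≤ (k : ℝ≥0) := h4
    have hk : ((k : ℝ≥0) : WithTop ℝ≥0) ≤ ((k + 1 : ℕ) : ℝ≥0) := by push_cast; exact_mod_cast le_self_add
    refine ⟨⟨⟨h1'.trans hk, fun h ↦ h2 ((hSmono k ω).trans h)⟩, ?_⟩, ⟨h4'.trans hk, fun h ↦ h5 ((hρmono k ω).trans h)⟩,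
      fun h ↦ h6 ((hSmono k ω).trans h)⟩
    show η (k + 1) < exRad (stoppedValue (fun t ω ↦ W t ω) τ ω)
    exact (hηanti k (k + 1) (Nat.le_succ k)).trans_lt h3'
  have hfmono : Monotone f := by
    refine monotone_nat_of_le_succ fun k ω ↦ ?_
    simp only [hfdef]
    by_cases hω : ω ∈ E k
    · rw [indicator_of_mem hω, indicator_of_mem (hEmono k hω)]
    · rw [indicator_of_notMem hω]; exact bot_le
  -- exhaustion along almost every path
  have hexh : ∀ᵐ ω ∂P, τ ω ≠ ⊤ → ∃ k, ω ∈ E k := by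
    filter_upwards [hW.ae_forall_pos_spRad_pos 0] with ω hoff hτne
    simp only [zero_add] at hoff
    have hoff' : ∀ s : ℝ≥0, 0 < s → 0 < exRad (W s ω) := hoff
    obtain ⟨T₀, hT₀⟩ := WithTop.ne_top_iff_exists.1 hτne
    have hT₀' : τ ω = T₀ := hT₀.symm
    have hmemF : W T₀ ω ∈ F := hW.mem_of_hitFrom_eq_coe hF hT₀'
    have hT₀pos : 0 < T₀ := by
      rw [pos_iff_ne_zero]; rintro rfl; exact hW0 ω hmemF
    set Tn : ℝ≥0 := dyadicCeil n T₀ with hTndef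
    have hτnω : τn ω = Tn := by
      show dyadicCeilTop n (τ ω) = Tn
      rw [hT₀', dyadicCeilTop_coe]
    have hT₀Tn : T₀ < Tn := lt_dyadicCeil n T₀
    have hXc : Continuous fun s : ℝ≥0 ↦ W s ω := hW.continuous_path ω
    -- (b) a bound on the path up to `Tn`
    obtain ⟨M, hM⟩ : ∃ M : ℝ, ∀ s ∈ Icc (0 : ℝ≥0) Tn, ‖W s ω‖ ≤ M := by
      obtain ⟨M, hM⟩ := isCompact_Icc.bddAbove_image hXc.norm.continuousOn
      exact ⟨M, fun s hs ↦ hM (mem_image_of_mem _ hs)⟩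
    obtain ⟨kb, hkb⟩ := exists_nat_ge M
    have hSgt : ∀ k, kb ≤ k → ¬ S k ω ≤ Tn := by
      intro k hk hle
      obtain ⟨T₁, hT₁⟩ := WithTop.ne_top_iff_exists.1 (ne_top_of_le_ne_top WithTop.coe_ne_top hle)
      have hmem : W T₁ ω ∈ Gk k := hW.mem_of_hitFrom_eq_coe (hGc k) hT₁.symm
      have hT₁le : T₁ ≤ Tn := by rw [← hT₁] at hle; exact_mod_cast hle
      have h1 : Rk k ≤ ‖W T₁ ω‖ := hmem
      have h2 : ‖W T₁ ω‖ ≤ M := hM T₁ ⟨bot_le, hT₁le⟩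
      have h3 : (kb : ℝ) ≤ k := by exact_mod_cast hk
      simp only [hRkdef] at h1
      linarith [abs_nonneg R₀]
    -- (c) the hit point is off the axis
    have hexτ : 0 < exRad (W T₀ ω) := hoff' T₀ hT₀pos
    obtain ⟨kc, hkc⟩ := exists_nat_one_div_lt hexτ
    -- (d) the path stays off the axis on `[T₀, Tn]`
    obtain ⟨m, hm0, hm⟩ : ∃ m : ℝ, 0 < m ∧ ∀ s ∈ Icc T₀ Tn, m ≤ exRad (W s ω) := by
      have hne : (Icc T₀ Tn).Nonempty := ⟨T₀, le_rfl, hT₀Tn.le⟩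
      obtain ⟨s₀, hs₀, hmin⟩ := isCompact_Icc.exists_isMinOn hne (continuous_exRad.comp hXc).continuousOn
      exact ⟨exRad (W s₀ ω), hoff' s₀ (hT₀pos.trans_le hs₀.1), fun s hs ↦ hmin hs⟩
    obtain ⟨kd, hkd⟩ := exists_nat_one_div_lt hm0
    have hρgt : ∀ k, kd ≤ k → ¬ ρ k ω ≤ Tn := by
      intro k hk hle
      obtain ⟨T₂, hT₂⟩ := WithTop.ne_top_iff_exists.1 (ne_top_of_le_ne_top WithTop.coe_ne_top hle)
      have hmem : W T₂ ω ∈ O k := mem_of_hittingFrom_eq_coe (hOc k) hXc hT₂.symm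
      have hT₂le : T₂ ≤ Tn := by rw [← hT₂] at hle; exact_mod_cast hle
      have hT₂ge : T₀ ≤ T₂ := by
        have := le_hittingFrom (u := fun t ω ↦ W t ω) (s := O k) (T := τ) (ω := ω)
        have h' : (T₀ : WithTop ℝ≥0) ≤ T₂ := by
          rw [← hT₀', hT₂]; exact this
        exact_mod_cast h'
      have h1 : exRad (W T₂ ω) ≤ η k := hmem
      have h2 : m ≤ exRad (W T₂ ω) := hm T₂ ⟨hT₂ge, hT₂le⟩
      have h3 : η k ≤ η kd := hηanti kd k hk
      have h4 : η kd < m := hkd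
      linarith
    -- (a) a level beyond `Tn`
    obtain ⟨ka, hka⟩ := exists_nat_ge (Tn : ℝ)
    refine ⟨max (max ka kb) (max kc kd), ?_⟩
    set k := max (max ka kb) (max kc kd) with hkdef
    have hka' : ka ≤ k := (le_max_left _ _).trans (le_max_left _ _)
    have hkb' : kb ≤ k := (le_max_right _ _).trans (le_max_left _ _)
    have hkc' : kc ≤ k := (le_max_left _ _).trans (le_max_right _ _)
    have hkd' : kd ≤ k := (le_max_right _ _).trans (le_max_right _ _)
    have hTnk : Tn ≤ (k : ℝ≥0) := by
      have : (Tn : ℝ) ≤ k := hka.trans (by exact_mod_cast hka')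
      exact_mod_cast this
    have hτk : τ ω ≤ (k : ℝ≥0) := by rw [hT₀']; exact_mod_cast hT₀Tn.le.trans hTnk
    have hτnk : τn ω ≤ (k : ℝ≥0) := by rw [hτnω]; exact_mod_cast hTnk
    have hSτ : ¬ S k ω ≤ τ ω := fun h ↦ hSgt k hkb' (h.trans (by rw [hT₀']; exact_mod_cast hT₀Tn.le))
    have hSτn : ¬ S k ω ≤ τn ω := fun h ↦ hSgt k hkb' (by rwa [hτnω] at h)
    have hρτn : ¬ ρ k ω ≤ τn ω := fun h ↦ hρgt k hkd' (by rwa [hτnω] at h)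
    have hexk : η k < exRad (stoppedValue (fun t ω ↦ W t ω) τ ω) := by
      have hsv : stoppedValue (fun t ω ↦ W t ω) τ ω = W T₀ ω := by simp only [stoppedValue, hT₀']; rfl
      rw [hsv]
      exact (hηanti kc k hkc').trans_lt hkc
    exact ⟨⟨⟨hτk, hSτ⟩, hexk⟩, ⟨hτnk, hρτn⟩, hSτn⟩
  -- the integrand of the statement is the supremum of the `f k`, almost everywhere
  have hsup : (fun ω ↦ {ω | τ ω ≠ ⊤}.indicator
      (fun ω ↦ ENNReal.ofReal (newtonR (W (dyadicCeil n (τ ω).untopA) ω))) ω) =ᵐ[P]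
      fun ω ↦ ⨆ k, f k ω := by
    filter_upwards [hexh] with ω hω
    by_cases hτne : τ ω ≠ ⊤
    · obtain ⟨k₀, hk₀⟩ := hω hτne
      obtain ⟨T₀, hT₀⟩ := WithTop.ne_top_iff_exists.1 hτne
      have huT : (τ ω).untopA = T₀ := by rw [← hT₀]; rfl
      have hsv : stoppedValue (fun t ω ↦ W t ω) τn ω = W (dyadicCeil n T₀) ω := by
        simp only [stoppedValue, hτndef, ← hT₀, dyadicCeilTop_coe]; rfl
      rw [indicator_of_mem (show ω ∈ {ω | τ ω ≠ ⊤} from hτne), huT]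
      refine le_antisymm ?_ ?_
      · refine le_iSup_of_le k₀ ?_
        simp only [hfdef]; rw [indicator_of_mem hk₀, hsv]
      · refine iSup_le fun k ↦ ?_
        simp only [hfdef]
        by_cases hk : ω ∈ E k
        · rw [indicator_of_mem hk, hsv]
        · rw [indicator_of_notMem hk]; exact bot_le
    · rw [indicator_of_notMem (show ω ∉ {ω | τ ω ≠ ⊤} from hτne)]
      symm
      refine le_antisymm (iSup_le fun k ↦ ?_) bot_le
      simp only [hfdef]
      rw [indicator_of_notMem]
      intro hk
      exact hτne (ne_top_of_le_ne_top WithTop.coe_ne_top (hk.1.1.1 : τ ω ≤ (k : ℝ≥0)))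
  rw [lintegral_congr_ae hsup, lintegral_iSup hfm hfmono]
  exact iSup_le hkey
end IsBrownianVec

end Literature.Probability.Process

end
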